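import Summits.BirchSwinnertonDyer.BirchSwinnertonDyer.Theorems.OneSidedTwistSqueezeX9KatoDivisibilityX9ReciprocityPkAnnihilator
import Summits.BirchSwinnertonDyer.BirchSwinnertonDyer.Theorems.OneSidedTwistSqueezeX9KatoDivisibilityX9KolyvaginReciprocityPkStepFour
import Summits.BirchSwinnertonDyer.BirchSwinnertonDyer.Theorems.SmallImageMuTransferMuTransferX9LocalSplitValues
import Summits.BirchSwinnertonDyer.BirchSwinnertonDyer.Theorems.OneSidedTwistSqueezeX9KatoDivisibilityX9KolyvaginReciprocityPkCocycle
import HarnessLib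

set_option autoImplicit false

-- the summit and its single problem are both named `BirchSwinnertonDyer` (registry layout D-0017)
set_option linter.dupNamespace false

/-!
# Crux `KatoDivisibilityX9` (stmt-BirchSwinnertonDyer-20547), line `graded_euler_loss`, stub `stub_reciprocityPkAX9`
# (1c′, hypothesis `hLocalPk`), file B: THE LOCAL TWIST `𝒯_J^{(k)}|_q` AT AN `E`-SPLIT PRIME — operator shape,
# transverse values `= ker ω(S) = g(S)·𝒯_J`, transverse classes with prescribed value, naturality for `End(M)`

Seat `bsd-line-k6-p4` (prover-bsd-line-k6-p4-g6-0, 6th LEAD).  THEOREMS ONLY; no definition, no named fact, no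
`sorry`; nothing is asserted about any curve; `--supports stmt-BirchSwinnertonDyer-20547` helper, closes nothing.
Level-`p^k` twins (`twistModP ↦ twistModPk`, `S^{p^m} ↦ ω(S) = ((X+1)^{p^m} − 1)(S)`, `S^{J−p^m}𝒯_J ↦ g(S)𝒯_J`) of
koly's `…X9LocalTwistOperator` §3, `…X9LocalSplitNaturality` §1 and `…X9LocalSplitValues` §SplitValues:
* §1 `toLocal_twistModPk_apply`, `…_of_apply_eq_one`, `…_apply_eq_self_iff_of_split` (fixed points of an
  `E`-split element of depth `m` = `ker ω(S)`), `range_toLocal_twistModPk_sub_one_of_split` (`= range ω(S)`),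
  `forall_toLocal_twistModPk_apply_eq_self_iff_of_split` (`(𝒯_J|_q)^{Γ_{K_q}} = ker ω(S)`),
  `toLocal_twistModPk_comp_endo(_of_split)` (every `φ₀ ∈ End(M)` is equivariant at an `E`-split prime).
* §2 `aeval_omega_aeval_eq_zero`
  (`ω(S)g(S) = 0` from `g·ω ≡ X^J`), `cocycle_apply_mem_ker_aeval_omega` / `exists_cocycle_apply_eq_aeval`
  (values of cocycles at a tame generator lie in `ker ω(S) = g(S)𝒯_J`), `exists_transverse_cocycle_apply_eq_aeval`
  (a transverse class with prescribed value `g(S)t`), `oneCocycleClass_eq_of_transverse_of_apply_eq_pk`.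

References: B. Mazur, K. Rubin, Mem. AMS 799 (2004) Lemma 1.2.1, §5.3 [MazurRubin2004]; K. Rubin, PCMI 18 (2011)
Prop. 1.9.5 [Rubin2011]; L. Washington, GTM 83, §13.1–13.2 [Washington1997].
-/

noncomputable section

open scoped Classical ContRepresentation
open Polynomial Finset
open Literature.NumberTheory.GaloisRepresentations
open Literature.NumberTheory.GaloisRepresentations.IsNonarchimedeanLocalField
open Literature.NumberTheory.GaloisCohomology
open Literature.NumberTheory.EllipticCurves
open Literature.NumberTheory.EllipticCurves.ZpExtension
open Field NumberField IsDedekindDomain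
open Summit.BirchSwinnertonDyer.Rank1Residual.GaloisImage
open Summit.BirchSwinnertonDyer.BirchSwinnertonDyer.Rank1Residual.LocalSplitPrime
open Summit.BirchSwinnertonDyer.BirchSwinnertonDyer.Theorems.OneSidedTwistSqueezeX9KatoDivisibilityX9ReciprocityPkAnnihilator
open Summit.BirchSwinnertonDyer.BirchSwinnertonDyer.Theorems.OneSidedTwistSqueezeX9KatoDivisibilityX9KolyvaginReciprocityPkStepFour
  (toLocal_twistModPk_apply_of_mem_absInertia)
open Summit.BirchSwinnertonDyer.BirchSwinnertonDyer.Theorems.OneSidedTwistSqueezeX9KatoDivisibilityX9KolyvaginReciprocityPkCocycle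
  (pow_sub_one_smul_eq_zero_of_dvd)

universe u

namespace Summit.BirchSwinnertonDyer.BirchSwinnertonDyer.Theorems.OneSidedTwistSqueezeX9KatoDivisibilityX9ReciprocityPkSplitValues

/-! ## §1 The local twist operator at level `p^k` -/

section Operator

variable {K : Type u} [Field K] [NumberField K] {M : Type u} [AddCommGroup M] [TopologicalSpace M]
  [DiscreteTopology M] (ρ : DiscreteGaloisModule K M) {p : ℕ} [Fact p.Prime] {k : ℕ}
  (hM : ∀ x : M, p ^ k • x = 0) (κ : ZpExtension K p) (J : ℕ) (q : HeightOneSpectrum (𝓞 K))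

/-- Unfolding: the local level-`p^k` twist acts by `(1+S)^{κ(res g) mod p^{J+k}} ∘ ρ(res g)`.
[cite: Washington1997, §13.1–§13.2] -/
theorem toLocal_twistModPk_apply (g : absoluteGaloisGroup (q.adicCompletion K)) (x : Fin J → M) :
    GaloisRep.toLocal q (κ.twistModPk ρ hM J) g x =
      unipotentPow M J (κ.twistExponent (J + k) (absGaloisRestrict K (q.adicCompletion K) g))
        (fun i => GaloisRep.toLocal q ρ g (x i)) := rfl

/-- **At an `E`-split element** (`ρ(res g) = 1`) the local twist acts by the unipotent operator alone.
[cite: Washington1997, §13.1–§13.2] -/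
theorem toLocal_twistModPk_apply_of_apply_eq_one {g : absoluteGaloisGroup (q.adicCompletion K)}
    (hg : ρ (absGaloisRestrict K (q.adicCompletion K) g) = 1) (x : Fin J → M) :
    GaloisRep.toLocal q (κ.twistModPk ρ hM J) g x =
      unipotentPow M J (κ.twistExponent (J + k) (absGaloisRestrict K (q.adicCompletion K) g)) x := by
  rw [toLocal_twistModPk_apply]
  congr 1
  funext i
  rw [GaloisRep.toLocal_apply, hg, Module.End.one_apply]

/-- **Fixed points of an `E`-split element of depth `m` are `ker ω(S)`**, `ω = (X+1)^{p^m} − 1`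
(level-`p^k` twin of `toLocal_twistModP_apply_eq_self_iff_of_split`). [cite: MazurRubin2004, Lemma 1.2.1 and §5.3] -/
theorem toLocal_twistModPk_apply_eq_self_iff_of_split {g : absoluteGaloisGroup (q.adicCompletion K)}
    (hg : ρ (absGaloisRestrict K (q.adicCompletion K) g) = 1) {m : ℕ} (hm : m + 1 ≤ J)
    (hgm : absGaloisRestrict K (q.adicCompletion K) g ∈ κ.layerSubgroup m)
    (hgm' : absGaloisRestrict K (q.adicCompletion K) g ∉ κ.layerSubgroup (m + 1)) (x : Fin J → M) :
    GaloisRep.toLocal q (κ.twistModPk ρ hM J) g x = x ↔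
      aeval (shiftEnd M J) ((X + 1 : ℤ[X]) ^ p ^ m - 1) x = 0 := by
  obtain ⟨u, hu, hb⟩ := twistExponent_eq_prime_pow_mul_of_depth κ (by omega : m + 1 ≤ J + k) hgm hgm'
  rw [toLocal_twistModPk_apply_of_apply_eq_one ρ hM κ J q hg, hb]
  exact unipotentPow_apply_eq_self_iff_aeval_omega hM m hu x

/-- **The image of `φ̃ − 1` for an `E`-split element of depth `m` is `ω(S)·𝒯_J`** (twin of
`range_toLocal_twistModP_sub_one_of_split`). [cite: MazurRubin2004, Lemma 1.2.1 and §5.3] -/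
theorem range_toLocal_twistModPk_sub_one_of_split {g : absoluteGaloisGroup (q.adicCompletion K)}
    (hg : ρ (absGaloisRestrict K (q.adicCompletion K) g) = 1) {m : ℕ} (hm : m + 1 ≤ J)
    (hgm : absGaloisRestrict K (q.adicCompletion K) g ∈ κ.layerSubgroup m)
    (hgm' : absGaloisRestrict K (q.adicCompletion K) g ∉ κ.layerSubgroup (m + 1)) :
    LinearMap.range ((GaloisRep.toLocal q (κ.twistModPk ρ hM J) g : (Fin J → M) →ₗ[ℤ] (Fin J → M)) - 1) =
      LinearMap.range (aeval (shiftEnd M J) ((X + 1 : ℤ[X]) ^ p ^ m - 1)) := by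
  obtain ⟨u, hu, hb⟩ := twistExponent_eq_prime_pow_mul_of_depth κ (by omega : m + 1 ≤ J + k) hgm hgm'
  have heq : ((GaloisRep.toLocal q (κ.twistModPk ρ hM J) g : (Fin J → M) →ₗ[ℤ] (Fin J → M)) - 1) =
      unipotentPow M J (p ^ m * u) - 1 := by
    refine LinearMap.ext fun x => ?_
    rw [LinearMap.sub_apply, LinearMap.sub_apply, ← hb]
    exact congrArg (· - _) (toLocal_twistModPk_apply_of_apply_eq_one ρ hM κ J q hg x)
  rw [heq]
  exact range_unipotentPow_sub_one_eq_range_aeval_omega hM m hu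

/-- **`(𝒯_J|_q)^{Γ_{K_q}} = ker ω(S)`** at a finite `q ∤ p` with `ρ` unramified and an `E`-split Frobenius of
depth `m`. [cite: MazurRubin2004, Lemma 1.2.1] [cite: Rubin2011, Prop. 1.9.5 (1) (p. 16)] -/
theorem forall_toLocal_twistModPk_apply_eq_self_iff_of_split
    (hunr : GaloisRep.IsUnramifiedAt q ρ) (hqp : (p : 𝓞 K) ∉ q.asIdeal)
    {φ : absoluteGaloisGroup (q.adicCompletion K)} (hφ : IsFrobPow φ 1)
    (hsplit : ρ (absGaloisRestrict K (q.adicCompletion K) φ) = 1) {m : ℕ} (hm : m + 1 ≤ J)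
    (hφm : absGaloisRestrict K (q.adicCompletion K) φ ∈ κ.layerSubgroup m)
    (hφm' : absGaloisRestrict K (q.adicCompletion K) φ ∉ κ.layerSubgroup (m + 1)) (x : Fin J → M) :
    (∀ g : absoluteGaloisGroup (q.adicCompletion K), GaloisRep.toLocal q (κ.twistModPk ρ hM J) g x = x) ↔
      aeval (shiftEnd M J) ((X + 1 : ℤ[X]) ^ p ^ m - 1) x = 0 := by
  have hI : ∀ t ∈ absInertia (q.adicCompletion K), ∀ y : Fin J → M,
      GaloisRep.toLocal q (κ.twistModPk ρ hM J) t y = y :=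
    fun _ ht y => toLocal_twistModPk_apply_of_mem_absInertia κ ρ hM J q hunr hqp ht y
  rw [forall_apply_eq_iff_of_isFrobPow (GaloisRep.toLocal q (κ.twistModPk ρ hM J)) hI hφ x]
  exact toLocal_twistModPk_apply_eq_self_iff_of_split ρ hM κ J q hsplit hm hφm hφm' x

/-- **Every additive endomorphism of `M` commutes with the local level-`p^k` twist** when `Γ_{K_q}` acts trivially
on `M`. [cite: MazurRubin2004, §1.3 and §5.3] -/
theorem toLocal_twistModPk_comp_endo
    (htriv : ∀ (g : absoluteGaloisGroup (q.adicCompletion K)) (m : M), GaloisRep.toLocal q ρ g m = m)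
    (φ : M →+ M) (g : absoluteGaloisGroup (q.adicCompletion K)) (x : Fin J → M) :
    GaloisRep.toLocal q (κ.twistModPk ρ hM J) g (fun i => φ (x i)) =
      fun i => φ (GaloisRep.toLocal q (κ.twistModPk ρ hM J) g x i) := by
  rw [toLocal_twistModPk_apply, toLocal_twistModPk_apply]
  have h1 : (fun i => GaloisRep.toLocal q ρ g (φ (x i))) = fun i => φ (x i) := funext fun i => htriv g _
  have h2 : (fun i => GaloisRep.toLocal q ρ g (x i)) = x := funext fun i => htriv g _
  rw [h1, h2]
  have h := LinearMap.congr_fun (ZpExtension.unipotentPow_mul_compLeft (M := M) (J := J)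
      (κ.twistExponent (J + k) (absGaloisRestrict K (q.adicCompletion K) g)) φ.toIntLinearMap) x
  simp only [Module.End.mul_apply] at h
  exact h

/-- The same at an `E`-split Frobenius. [cite: MazurRubin2004, §1.3 and §5.3] -/
theorem toLocal_twistModPk_comp_endo_of_split (hunr : GaloisRep.IsUnramifiedAt q ρ)
    {φF : absoluteGaloisGroup (q.adicCompletion K)} (hφF : IsFrobPow φF 1)
    (hsplit : ρ (absGaloisRestrict K (q.adicCompletion K) φF) = 1)
    (φ : M →+ M) (g : absoluteGaloisGroup (q.adicCompletion K)) (x : Fin J → M) :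
    GaloisRep.toLocal q (κ.twistModPk ρ hM J) g (fun i => φ (x i)) =
      fun i => φ (GaloisRep.toLocal q (κ.twistModPk ρ hM J) g x i) :=
  toLocal_twistModPk_comp_endo ρ hM κ J q (toLocal_apply_eq_self_of_split ρ q hunr hφF hsplit) φ g x

end Operator

/-! ## §2 Transverse values and transverse classes with prescribed value -/

section Values

variable {K : Type u} [Field K] [NumberField K] {p : ℕ} [Fact p.Prime] {k : ℕ}
  {M : Type u} [AddCommGroup M] [TopologicalSpace M] [DiscreteTopology M] [Finite M]
  (ρ : DiscreteGaloisModule K M) (hM : ∀ x : M, p ^ k • x = 0) (κ : ZpExtension K p) (J : ℕ)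
  (q : HeightOneSpectrum (𝓞 K)) [Fact (Ideal.absNorm q.asIdeal).Prime]
  [NeZero ((Ideal.absNorm q.asIdeal : ℕ) : q.adicCompletion K)]

omit [Fact p.Prime] [TopologicalSpace M] [DiscreteTopology M] [Finite M] in
/-- `ω(S)·g(S) = 0` on `Fin J → M` (`p^k·M = 0`) when `g·ω ≡ X^J` coefficientwise modulo `p^k` in degrees `< J`.
[cite: Washington1997, §7.1–§7.2] -/
theorem aeval_omega_aeval_eq_zero (hM : ∀ x : M, p ^ k • x = 0) {ω g : ℤ[X]}
    (hrel : ∀ i, i < J → ((p ^ k : ℕ) : ℤ) ∣ (g * ω - X ^ J).coeff i) (t : Fin J → M) :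
    aeval (shiftEnd M J) ω (aeval (shiftEnd M J) g t) = 0 := by
  rw [← Module.End.mul_apply, ← map_mul, mul_comm,
    Summit.BirchSwinnertonDyer.BirchSwinnertonDyer.Theorems.OneSidedTwistSqueezeX9KatoDivisibilityX9StubReciprocityPkX9Transfer.aeval_shiftEnd_apply_eq_of_forall_dvd_coeff_sub
      hM (g * ω) (X ^ J) hrel t,
    map_pow, aeval_X, shiftEnd_pow_eq_zero le_rfl, LinearMap.zero_apply]

/-- **Values of cocycles at a tame generator are `Γ_{K_q}`-fixed, hence in `ker ω(S)`** at an `E`-split Frobenius of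
depth `m` (`p^k ∣ ℓ − 1`, `χ̄_ℓ` onto on inertia). [cite: Rubin2011, Prop. 1.9.5 (1) (p. 16)] -/
theorem cocycle_apply_mem_ker_aeval_omega (hunr : GaloisRep.IsUnramifiedAt q ρ)
    (hqp : (p : 𝓞 K) ∉ q.asIdeal) (hpl : p ^ k ∣ Ideal.absNorm q.asIdeal - 1)
    (hχI : ∀ u : (ZMod (Ideal.absNorm q.asIdeal))ˣ, ∃ t ∈ absInertia (q.adicCompletion K),
      modPCyclotomicCharacterZMod (q.adicCompletion K) (Ideal.absNorm q.asIdeal) t = u)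
    {Fr : absoluteGaloisGroup (q.adicCompletion K)}
    (hsplit : ρ (absGaloisRestrict K (q.adicCompletion K) Fr) = 1) {m : ℕ} (hm : m + 1 ≤ J)
    (hFrm : absGaloisRestrict K (q.adicCompletion K) Fr ∈ κ.layerSubgroup m)
    (hFrm' : absGaloisRestrict K (q.adicCompletion K) Fr ∉ κ.layerSubgroup (m + 1))
    (φ : contOneCocycles (GaloisRep.toLocal q (κ.twistModPk ρ hM J)).toTopRep)
    {t₀ : absoluteGaloisGroup (q.adicCompletion K)} (ht₀ : t₀ ∈ absInertia (q.adicCompletion K)) :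
    aeval (shiftEnd M J) ((X + 1 : ℤ[X]) ^ p ^ m - 1) (φ.1 t₀) = 0 := by
  have hI : ∀ t ∈ absInertia (q.adicCompletion K), ∀ x : Fin J → M,
      GaloisRep.toLocal q (κ.twistModPk ρ hM J) t x = x :=
    fun _ ht x => toLocal_twistModPk_apply_of_mem_absInertia κ ρ hM J q hunr hqp ht x
  have hfix : GaloisRep.toLocal q (κ.twistModPk ρ hM J) Fr (φ.1 t₀) = φ.1 t₀ :=
    apply_cocycle_apply_eq_self_of_mem_absInertia _ (Ideal.absNorm q.asIdeal)
      (ringChar_residueField_adicCompletion_eq q) hI (pow_sub_one_smul_eq_zero_of_dvd hM J hpl) hχI φ ht₀ Fr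
  exact (toLocal_twistModPk_apply_eq_self_iff_of_split ρ hM κ J q hsplit hm hFrm hFrm' _).1 hfix

/-- **Values of cocycles at a tame generator lie in `g(S)·𝒯_J`** once `ker ω(S) = range g(S)` (file A).
[cite: Rubin2011, Prop. 1.9.5 (1) (p. 16)] [cite: MazurRubin2004, Lemma 1.2.1] -/
theorem exists_cocycle_apply_eq_aeval (hunr : GaloisRep.IsUnramifiedAt q ρ)
    (hqp : (p : 𝓞 K) ∉ q.asIdeal) (hpl : p ^ k ∣ Ideal.absNorm q.asIdeal - 1)
    (hχI : ∀ u : (ZMod (Ideal.absNorm q.asIdeal))ˣ, ∃ t ∈ absInertia (q.adicCompletion K),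
      modPCyclotomicCharacterZMod (q.adicCompletion K) (Ideal.absNorm q.asIdeal) t = u)
    {Fr : absoluteGaloisGroup (q.adicCompletion K)}
    (hsplit : ρ (absGaloisRestrict K (q.adicCompletion K) Fr) = 1) {m : ℕ} (hm : m + 1 ≤ J)
    (hFrm : absGaloisRestrict K (q.adicCompletion K) Fr ∈ κ.layerSubgroup m)
    (hFrm' : absGaloisRestrict K (q.adicCompletion K) Fr ∉ κ.layerSubgroup (m + 1))
    {g : ℤ[X]}
    (hval : LinearMap.ker (aeval (shiftEnd M J) ((X + 1 : ℤ[X]) ^ p ^ m - 1)) =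
      LinearMap.range (aeval (shiftEnd M J) g))
    (φ : contOneCocycles (GaloisRep.toLocal q (κ.twistModPk ρ hM J)).toTopRep)
    {t₀ : absoluteGaloisGroup (q.adicCompletion K)} (ht₀ : t₀ ∈ absInertia (q.adicCompletion K)) :
    ∃ t : Fin J → M, φ.1 t₀ = aeval (shiftEnd M J) g t := by
  have hmem : φ.1 t₀ ∈ LinearMap.ker (aeval (shiftEnd M J) ((X + 1 : ℤ[X]) ^ p ^ m - 1)) :=
    (LinearMap.mem_ker).2 (cocycle_apply_mem_ker_aeval_omega ρ hM κ J q hunr hqp hpl hχI hsplit hm hFrm hFrm' φ ht₀)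
  rw [hval, LinearMap.mem_range] at hmem
  obtain ⟨t, ht⟩ := hmem
  exact ⟨t, ht.symm⟩

/-- **A transverse class with prescribed value `g(S)·t`** (`ω(S)g(S) = 0` makes the value `Γ_{K_q}`-invariant;
`H¹_tr ≅ (𝒯_J|_q)^{Γ_{K_q}}` by evaluation at the tame generator `t₀`). [cite: Rubin2011, Prop. 1.9.5 (1) (p. 16)] -/
theorem exists_transverse_cocycle_apply_eq_aeval (hunr : GaloisRep.IsUnramifiedAt q ρ)
    (hqp : (p : 𝓞 K) ∉ q.asIdeal) (hpl : p ^ k ∣ Ideal.absNorm q.asIdeal - 1)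
    (hχI : ∀ u : (ZMod (Ideal.absNorm q.asIdeal))ˣ, ∃ t ∈ absInertia (q.adicCompletion K),
      modPCyclotomicCharacterZMod (q.adicCompletion K) (Ideal.absNorm q.asIdeal) t = u)
    {Fr : absoluteGaloisGroup (q.adicCompletion K)} (hFr : IsAbsArithFrob Fr)
    (hsplit : ρ (absGaloisRestrict K (q.adicCompletion K) Fr) = 1) {m : ℕ} (hm : m + 1 ≤ J)
    (hFrm : absGaloisRestrict K (q.adicCompletion K) Fr ∈ κ.layerSubgroup m)
    (hFrm' : absGaloisRestrict K (q.adicCompletion K) Fr ∉ κ.layerSubgroup (m + 1))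
    {t₀ : absoluteGaloisGroup (q.adicCompletion K)} (ht₀ : t₀ ∈ absInertia (q.adicCompletion K))
    (hgen : ∀ u : (ZMod (Ideal.absNorm q.asIdeal))ˣ,
      u ∈ Subgroup.zpowers (modPCyclotomicCharacterZMod (q.adicCompletion K) (Ideal.absNorm q.asIdeal) t₀))
    {g : ℤ[X]} (hrel : ∀ i, i < J → ((p ^ k : ℕ) : ℤ) ∣ (g * ((X + 1 : ℤ[X]) ^ p ^ m - 1) - X ^ J).coeff i)
    (t : Fin J → M) :
    ∃ φ : contOneCocycles (GaloisRep.toLocal q (κ.twistModPk ρ hM J)).toTopRep,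
      oneCocycleClass _ φ ∈ DiscreteGaloisModule.transverseSubgroup (GaloisRep.toLocal q (κ.twistModPk ρ hM J))
        (CyclotomicField (Ideal.absNorm q.asIdeal) (q.adicCompletion K)) ∧
      φ.1 t₀ = aeval (shiftEnd M J) g t := by
  have hI : ∀ t ∈ absInertia (q.adicCompletion K), ∀ x : Fin J → M,
      GaloisRep.toLocal q (κ.twistModPk ρ hM J) t x = x :=
    fun _ ht x => toLocal_twistModPk_apply_of_mem_absInertia κ ρ hM J q hunr hqp ht x
  obtain ⟨e, he⟩ := exists_transverseSubgroup_addEquiv_invariants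
    (GaloisRep.toLocal q (κ.twistModPk ρ hM J)) (Ideal.absNorm q.asIdeal)
    (ringChar_residueField_adicCompletion_eq q) hI (pow_sub_one_smul_eq_zero_of_dvd hM J hpl) hχI ht₀ hgen
  -- the prescribed value is `Γ_{K_q}`-invariant
  have hzero : aeval (shiftEnd M J) ((X + 1 : ℤ[X]) ^ p ^ m - 1) (aeval (shiftEnd M J) g t) = 0 :=
    aeval_omega_aeval_eq_zero J hM hrel t
  have hv : aeval (shiftEnd M J) g t ∈ (GaloisRep.toLocal q (κ.twistModPk ρ hM J)).toTopRep.ρ.invariants :=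
    fun g' => (forall_toLocal_twistModPk_apply_eq_self_iff_of_split ρ hM κ J q hunr hqp
      (IsAbsArithFrob.isFrobPow_holds hFr) hsplit hm hFrm hFrm' _).2 hzero g'
  set c := e.symm ⟨_, hv⟩ with hc
  obtain ⟨φ, hφ⟩ := oneCocycleClass_surjective _ c.1
  have hφtr : oneCocycleClass _ φ ∈ DiscreteGaloisModule.transverseSubgroup
      (GaloisRep.toLocal q (κ.twistModPk ρ hM J))
      (CyclotomicField (Ideal.absNorm q.asIdeal) (q.adicCompletion K)) := by
    rw [hφ]; exact c.2
  refine ⟨φ, hφtr, ?_⟩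
  have h1 : (⟨oneCocycleClass _ φ, hφtr⟩ : DiscreteGaloisModule.transverseSubgroup
      (GaloisRep.toLocal q (κ.twistModPk ρ hM J))
      (CyclotomicField (Ideal.absNorm q.asIdeal) (q.adicCompletion K))) = c := Subtype.ext hφ
  rw [← he φ hφtr, h1, hc, AddEquiv.apply_symm_apply]

/-- **Transverse classes of the level-`p^k` twist are determined by their value at `t₀`.**
[cite: Rubin2011, Prop. 1.9.5 (1) (p. 16)] -/
theorem oneCocycleClass_eq_of_transverse_of_apply_eq_pk (hunr : GaloisRep.IsUnramifiedAt q ρ)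
    (hqp : (p : 𝓞 K) ∉ q.asIdeal) (hpl : p ^ k ∣ Ideal.absNorm q.asIdeal - 1)
    (hχI : ∀ u : (ZMod (Ideal.absNorm q.asIdeal))ˣ, ∃ t ∈ absInertia (q.adicCompletion K),
      modPCyclotomicCharacterZMod (q.adicCompletion K) (Ideal.absNorm q.asIdeal) t = u)
    {t₀ : absoluteGaloisGroup (q.adicCompletion K)} (ht₀ : t₀ ∈ absInertia (q.adicCompletion K))
    (hgen : ∀ u : (ZMod (Ideal.absNorm q.asIdeal))ˣ,
      u ∈ Subgroup.zpowers (modPCyclotomicCharacterZMod (q.adicCompletion K) (Ideal.absNorm q.asIdeal) t₀))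
    (φ₁ φ₂ : contOneCocycles (GaloisRep.toLocal q (κ.twistModPk ρ hM J)).toTopRep)
    (h₁ : oneCocycleClass _ φ₁ ∈ DiscreteGaloisModule.transverseSubgroup (GaloisRep.toLocal q (κ.twistModPk ρ hM J))
        (CyclotomicField (Ideal.absNorm q.asIdeal) (q.adicCompletion K)))
    (h₂ : oneCocycleClass _ φ₂ ∈ DiscreteGaloisModule.transverseSubgroup (GaloisRep.toLocal q (κ.twistModPk ρ hM J))
        (CyclotomicField (Ideal.absNorm q.asIdeal) (q.adicCompletion K)))
    (h : φ₁.1 t₀ = φ₂.1 t₀) :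
    oneCocycleClass _ φ₁ = oneCocycleClass _ φ₂ := by
  have hI : ∀ t ∈ absInertia (q.adicCompletion K), ∀ x : Fin J → M,
      GaloisRep.toLocal q (κ.twistModPk ρ hM J) t x = x :=
    fun _ ht x => toLocal_twistModPk_apply_of_mem_absInertia κ ρ hM J q hunr hqp ht x
  rw [← sub_eq_zero, ← oneCocycleClass_sub]
  refine eq_zero_of_mem_transverseSubgroup_of_apply_eq_zero _ (Ideal.absNorm q.asIdeal)
    (ringChar_residueField_adicCompletion_eq q) hI (pow_sub_one_smul_eq_zero_of_dvd hM J hpl) hχI ht₀ hgen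
    (φ₁ - φ₂) ?_ ?_
  · rw [oneCocycleClass_sub]; exact AddSubgroup.sub_mem _ h₁ h₂
  · rw [Submodule.coe_sub, ContinuousMap.sub_apply, h, sub_self]

end Values

end Summit.BirchSwinnertonDyer.BirchSwinnertonDyer.Theorems.OneSidedTwistSqueezeX9KatoDivisibilityX9ReciprocityPkSplitValues

end
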